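/-
Copyright (c) 2026 the pub-hodgecm-mathlib formalisation cell (harness21).  Prover seat hodgecm-mathlib-K2E4-p10 (g7), Track B ∕ K2-LIT, h413 = `stmt-HodgeConjecture-24833`,
line `K2_E1_TraceFormulaBeta`, 5Res ROADCARD «ENDGAME BY FAMILIES» §3′ M2 v2 (K2E1-plan (g7), (237)(a)) file D4′c (SD) part 5: the AUTOMORPHIC INSTANTIATION of the self-dual block
isometry — pure-tensor two-term letters ⇒ vector Gram letter (sesquilinearity), the `L²(K_U)`-packaging of a finite family of sections as a finite-dimensional submodule of `Lp ℂ 2 μK`, and the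
`U(1,1)_{L∕L⁺}` print over ★ part 4b.
-/
import Summits.HodgeConjecture.HodgeConjecture.Theorems.K2E1ChiSectionPlancherelSelfDualOfLetters    -- ★ part 4b p860321 (+ parts 1∕2∕3∕4a, ★ (OD) p860123 transitively)
import HarnessLib

/-!
# D4′c (SD) part 5 — `K2E1ChiSectionPlancherelSelfDualCMTwo`: the self-dual block isometry for section fields `Ψ_i = Σ_a f_{i,a} ⊗ φ_a` from PURE-TENSOR two-term letters, with the
# `L²(K_U)`-model `V = span{[φ_a|_{K_U}]} ≤ L²(K_U, μ_K)` of the section space, printed for `U(1,1)_{L∕L⁺}`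

Track B ∕ K2-LIT, crux h413 = `stmt-HodgeConjecture-24833`, route of record `HCCMUnconditional`; cell `hodgecm-mathlib`, squad K2, ENGINE E1.  THEOREMS ONLY (no `def`, no `instance`,
no `notation`, no named-fact hypothesis, no `sorry`; default heartbeats); lane `--supports stmt-HodgeConjecture-24833 --as helper` (count-neutral).
THE MATHEMATICS ([MoeglinWaldspurger1995, II.1.7, II.2.1–II.2.4, IV.3.12]; [GelbartRogawski1991, §3.1]).  (§1, generic) If the classes `y_{i,a}` (E1: `[θ_{f_{i,a}, φ_a}] ∈ L²(X,μ)`) have the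
PURE-TENSOR two-term Gram form on `Re z = σ₀`
`⟪y_{i,b}, y_{j,a}⟫ = C·(2π)⁻¹∫_ℝ f̃_{j,a}(−z)·(⟪v_b, v_a⟫·conj f̃_{i,b}(−(1−z̄)) + ⟪v_b, M(z)v_a⟫·conj f̃_{i,b}(−z̄)) dy` (`v_a ∈ V` the model vectors of the sections, `M(z) ∈ End V` the
intertwining operator — MW II.2.1: `M(w,π)` acts on the UNCONJUGATED series, i.e. on the second slot of Mathlib's `⟪·,·⟫`), then by sesquilinearity (★ part 2 `vectorIntegrand_eq_sum_sum`,
`∫Σ = Σ∫` by the entry integrability ★ part 2 §1) the sums `x_i := Σ_a y_{i,a}` (the classes of `θ_{Ψ_i}`, `Ψ_i = Σ_a f_{i,a} ⊗ φ_a`) have EXACTLY the vector Gram letter `hGram` of ★ part 4b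
`exists_linearIsometry_selfDual_of_letters`; so (§2) the self-dual block isometry holds for the `x_i` under the same entry-MS ∕ FE ∕ adjoint ∕ positivity letters.  (§3) THE `L²(K_U)`-MODEL:
for finitely many continuous bounded `χ`-sections `φ_a` on `G(𝔸) = U(1,1)(𝔸_{L⁺})` the restrictions `φ_a|_{K_U}` are in `L²(K_U, μ_K)` (`μ_K` finite), any representatives `v_a` span a
FINITE-DIMENSIONAL submodule `W ≤ Lp ℂ 2 μK` — a complete inner-product space in its own right, no `def` needed — with `⟪v_b, v_a⟫_W = ∫_{K_U} φ_a·conj φ_b dμ_K` (the `L²(K_U)`-pairing of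
★ W-b's output); the classes `y_{i,a} = [θ_{f_{i,a},φ_a}] ∈ L²(X, μ)` exist (★ (OD) §3).  §4 prints the `U(1,1)_{L∕L⁺}` HEAD with `V := ↥W`, vectors `⟨v_a, _⟩`, `M : ℂ → End W` and the
letters verbatim — the consumer (H-χ (SD), K2E3-p12; (b)-block entry letters, K2E1-p14; C3∕hconj, K2E1-p13) discharges them BY NAME.
* §1 `inner_sum_sum_eq_vectorGram` (pure-tensor letters ⇒ vector Gram letter).  * §2 **`exists_linearIsometry_selfDual_of_pureTensor_letters`** (generic `H`, `V`).
* §3 `memLp_two_section_restrict`, `exists_sectionRep`, `inner_mk_span_eq_integral` (the `L²(K_U)` packaging; finite-dimensionality `finiteDimensional_span_range`).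
* §4 **`exists_linearIsometry_chiSection_selfDual_cm_two`** (the `U(1,1)_{L∕L⁺}` print: `H = L²(X,μ)`, `V = ↥(span {v_a}) ≤ L²(K_U)`).
HONEST LABEL: HC_CM is proved only modulo the 7 printed citations (2 remaining named inputs: hLiu418 = `stmt-HodgeConjecture-24832`, h413 = `stmt-HodgeConjecture-24833`) until rung 0
closes; this file asserts no named fact, closes no socket; count-neutral; letters: pure-tensor two-term Gram (H-χ (SD)), entry MS, FE∕adjoint∕axis continuity, residue positivity.

## References
* [MoeglinWaldspurger1995] C. Mœglin, J.-L. Waldspurger, *Spectral decomposition and Eisenstein series* (1995), II.1.7, II.2.1–II.2.4, IV.3.12.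
* [GelbartRogawski1991] S. Gelbart, J. Rogawski, *L-functions and Fourier–Jacobi coefficients for the unitary group U(3)*, Invent. Math. 105 (1991), §3.1.
-/

set_option autoImplicit false
set_option linter.dupNamespace false  -- the mandated namespace repeats the summit's segment (`HodgeConjecture.HodgeConjecture`)

noncomputable section

open MeasureTheory Measure Set Filter Topology Complex NumberField
open scoped Real ComplexConjugate InnerProductSpace BigOperators
open Literature.NumberTheory Literature.NumberTheory.Automorphic Literature.NumberTheory.Automorphic.UnitaryGroup AdelicGroupData
open Literature.NumberTheory.GaloisRepresentations (HeckeCharacter)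
open Summit.HodgeConjecture.HodgeConjecture.Cruxes.H413.K2E1BorelEisensteinU
open Summit.HodgeConjecture.HodgeConjecture.Cruxes.H413.K2E1CharacterEisensteinU2Defs
open Summit.HodgeConjecture.HodgeConjecture.Cruxes.H413.K2E1PseudoEisensteinContourShiftVector (vectorIntegrand_eq_sum_sum integrable_innerProductIntegrand_const_vertical_of_finset)
open Summit.HodgeConjecture.HodgeConjecture.Cruxes.H413.K2E1ChiSectionPlancherelSelfDualOfLetters (exists_linearIsometry_selfDual_of_letters)
open Summit.HodgeConjecture.HodgeConjecture.Cruxes.H413.K2E1ChiSectionPlancherelKTypeCMTwo (memLp_quotFun_chiPseudoEisenstein_cm_two inner_eq_integral_mul_conj)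
open Summit.HodgeConjecture.HodgeConjecture.Cruxes.H413.K2E1PlancherelIsometryOfForm (mem_topologicalClosure_span)

namespace Summit.HodgeConjecture.HodgeConjecture.Cruxes.H413.K2E1ChiSectionPlancherelSelfDualCMTwo

/-! ## §1 Pure-tensor two-term letters ⇒ the vector Gram letter (sesquilinearity) -/

section Generic

variable {V : Type*} [NormedAddCommGroup V] [InnerProductSpace ℂ V] {H : Type*} [NormedAddCommGroup H] [InnerProductSpace ℂ H] {ι α : Type*} [Fintype α]

/-- **PURE-TENSOR TWO-TERM LETTERS ⇒ THE VECTOR GRAM LETTER.**  If `⟪y_{i,b}, y_{j,a}⟫ = C·((2π)⁻¹·∫_ℝ F_{(j,a),(i,b)}(σ₀+iy) dy)` with the entry integrand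
`F = f̃_{j,a}(−z)·(⟪v_b, v_a⟫·conj f̃_{i,b}(−(1−z̄)) + ⟪v_b, M(z)v_a⟫·conj f̃_{i,b}(−z̄))` integrable on the line for all entries, then the sums `x_i = Σ_a y_{i,a}` satisfy the vector Gram
letter `⟪x_i, x_j⟫ = C·((2π)⁻¹·∫_ℝ (⟪Ψ̂_i(−(1−z̄)), Ψ̂_j(−z)⟫ + ⟪Ψ̂_i(−z̄), M(z)Ψ̂_j(−z)⟫) dy)`, `Ψ̂_i(w) = Σ_a f̃_{i,a}(w)•v_a` (★ part 2 `vectorIntegrand_eq_sum_sum`).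
[cite: MoeglinWaldspurger1995, II.2.1] -/
theorem inner_sum_sum_eq_vectorGram (y : ι → α → H) (v : α → V) (M : ℂ → V →ₗ[ℂ] V) (f : ι → α → ℝ → ℂ) {C : ℝ} {σ₀ : ℝ}
    (hint : ∀ i j a b, Integrable fun t : ℝ => mellin (f j a) (-((σ₀ : ℂ) + t * I)) *
      (⟪v b, v a⟫_ℂ * conj (mellin (f i b) (-(1 - conj ((σ₀ : ℂ) + t * I)))) + ⟪v b, M ((σ₀ : ℂ) + t * I) (v a)⟫_ℂ * conj (mellin (f i b) (-conj ((σ₀ : ℂ) + t * I)))))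
    (hSD : ∀ i j a b, ⟪y i b, y j a⟫_ℂ = (C : ℂ) * ((((2 * π)⁻¹ : ℝ) : ℂ) * ∫ t : ℝ, mellin (f j a) (-((σ₀ : ℂ) + t * I)) *
      (⟪v b, v a⟫_ℂ * conj (mellin (f i b) (-(1 - conj ((σ₀ : ℂ) + t * I)))) + ⟪v b, M ((σ₀ : ℂ) + t * I) (v a)⟫_ℂ * conj (mellin (f i b) (-conj ((σ₀ : ℂ) + t * I))))))
    (i j : ι) :
    ⟪∑ b, y i b, ∑ a, y j a⟫_ℂ = (C : ℂ) * ((((2 * π)⁻¹ : ℝ) : ℂ) * ∫ t : ℝ,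
      (⟪∑ b, mellin (f i b) (-(1 - conj ((σ₀ : ℂ) + t * I))) • v b, ∑ a, mellin (f j a) (-((σ₀ : ℂ) + t * I)) • v a⟫_ℂ +
        ⟪∑ b, mellin (f i b) (-conj ((σ₀ : ℂ) + t * I)) • v b, M ((σ₀ : ℂ) + t * I) (∑ a, mellin (f j a) (-((σ₀ : ℂ) + t * I)) • v a)⟫_ℂ)) := by
  -- the vector integrand is the finite sum of the entry integrands, and `∫Σ = Σ∫`
  have hI : ∫ t : ℝ, (⟪∑ b, mellin (f i b) (-(1 - conj ((σ₀ : ℂ) + t * I))) • v b, ∑ a, mellin (f j a) (-((σ₀ : ℂ) + t * I)) • v a⟫_ℂ +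
        ⟪∑ b, mellin (f i b) (-conj ((σ₀ : ℂ) + t * I)) • v b, M ((σ₀ : ℂ) + t * I) (∑ a, mellin (f j a) (-((σ₀ : ℂ) + t * I)) • v a)⟫_ℂ) =
      ∑ a, ∑ b, ∫ t : ℝ, mellin (f j a) (-((σ₀ : ℂ) + t * I)) *
        (⟪v b, v a⟫_ℂ * conj (mellin (f i b) (-(1 - conj ((σ₀ : ℂ) + t * I)))) + ⟪v b, M ((σ₀ : ℂ) + t * I) (v a)⟫_ℂ * conj (mellin (f i b) (-conj ((σ₀ : ℂ) + t * I)))) := by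
    simp_rw [vectorIntegrand_eq_sum_sum]
    rw [integral_finsetSum _ fun a _ => integrable_finsetSum _ fun b _ => hint i j a b]
    exact Finset.sum_congr rfl fun a _ => integral_finsetSum _ fun b _ => hint i j a b
  rw [hI, sum_inner]
  simp_rw [inner_sum, hSD]
  rw [Finset.sum_comm]
  simp only [Finset.mul_sum]

/-! ## §2 The self-dual block isometry from pure-tensor letters (generic `H`, `V`) -/

/-- **THE SELF-DUAL BLOCK ISOMETRY FROM PURE-TENSOR LETTERS.**  As ★ part 4b `exists_linearIsometry_selfDual_of_letters`, but with the Gram letter stated for the PURE TENSORS `y_{i,a}`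
(E1: `[θ_{f_{i,a},φ_a}]`): the family `x_i := Σ_a y_{i,a}` (the classes of `θ_{Ψ_i}`, `Ψ_i = Σ_a f_{i,a} ⊗ φ_a`) is isometric to `(⊕_{c∈S} V) ⊕₂ L²((0,∞); V)` on its closed span:
`∃ r w U`, `⟪r_i, r_j⟫ = C·Σ_c ⟪Ψ̂_i(−c), R_c Ψ̂_j(−c)⟫`, `w_i =ᵐ U_i`, **`U (Σ_a y_{i,a}) = (r_i, √(C∕2π) • w_i)`**.  The entry integrability on `Re z = σ₀` comes from the MS entry letters
(★ part 2 §1). [cite: MoeglinWaldspurger1995, II.2.4, IV.3.12] -/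
theorem exists_linearIsometry_selfDual_of_pureTensor_letters [FiniteDimensional ℂ V]
    (y : ι → α → H) {f : ι → α → ℝ → ℂ}
    (hf : ∀ i a, ContDiff ℝ 2 (f i a)) (hfs : ∀ i a, HasCompactSupport (f i a)) (hf0 : ∀ i a, tsupport (f i a) ⊆ Ioi 0)
    (v : α → V) (M : ℂ → V →ₗ[ℂ] V) {σ₀ : ℝ} (hσ₀ : 1 / 2 < σ₀)
    {U : Set ℂ} (hUo : IsOpen U) (hUs : {z : ℂ | 1 / 2 ≤ z.re ∧ z.re ≤ σ₀} ⊆ U) (S : Finset ℝ) (hS : ∀ c ∈ S, 1 / 2 < c ∧ c < σ₀)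
    (hs : ∀ a b, DifferentiableOn ℂ (fun z : ℂ => ⟪v b, M z (v a)⟫_ℂ) (U \ ((S.image fun c : ℝ => (c : ℂ)) : Set ℂ)))
    (R : ℝ → V →ₗ[ℂ] V) (hr : ∀ a b, ∀ c ∈ S, Tendsto (fun z : ℂ => (z - c) * ⟪v b, M z (v a)⟫_ℂ) (𝓝[≠] (c : ℂ)) (𝓝 ⟪v b, R c (v a)⟫_ℂ))
    {B : ℝ} (hB : ∀ a b, ∀ z : ℂ, 1 / 2 < z.re → z.re ≤ σ₀ → 1 ≤ |z.im| → ‖⟪v b, M z (v a)⟫_ℂ‖ ≤ B)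
    (hRsymm : ∀ c ∈ S, ∀ u u' : V, ⟪u, R c u'⟫_ℂ = ⟪R c u, u'⟫_ℂ) (hRpos : ∀ c ∈ S, ∀ u : V, 0 ≤ RCLike.re ⟪u, R c u⟫_ℂ)
    {P : Set ℂ} (hPcd : ∀ z₀ : ℂ, ∀ᶠ w in 𝓝[≠] z₀, w ∉ P)
    (hFE : ∀ z : ℂ, z ∉ P → 1 - z ∉ P → ∀ u : V, M (1 - z) (M z u) = u) (hadj : ∀ z : ℂ, z ∉ P → conj z ∉ P → ∀ u u' : V, ⟪u, M z u'⟫_ℂ = ⟪M (conj z) u, u'⟫_ℂ)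
    (hcont : ∀ u : V, Continuous fun t : ℝ => M ((((1 / 2 : ℝ)) : ℂ) + t * I) u)
    {C : ℝ} (hC : 0 ≤ C)
    (hSD : ∀ i j a b, ⟪y i b, y j a⟫_ℂ = (C : ℂ) * ((((2 * π)⁻¹ : ℝ) : ℂ) * ∫ t : ℝ, mellin (f j a) (-((σ₀ : ℂ) + t * I)) *
      (⟪v b, v a⟫_ℂ * conj (mellin (f i b) (-(1 - conj ((σ₀ : ℂ) + t * I)))) + ⟪v b, M ((σ₀ : ℂ) + t * I) (v a)⟫_ℂ * conj (mellin (f i b) (-conj ((σ₀ : ℂ) + t * I)))))) :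
    ∃ (r : ι → PiLp 2 (fun _ : ↥S => V)) (w : ι → Lp V 2 ((volume : Measure ℝ).restrict (Ioi 0)))
      (Uiso : (Submodule.span ℂ (Set.range fun i => ∑ a, y i a)).topologicalClosure →ₗᵢ[ℂ] WithLp 2 (PiLp 2 (fun _ : ↥S => V) × Lp V 2 ((volume : Measure ℝ).restrict (Ioi 0)))),
      (∀ i j, ⟪r i, r j⟫_ℂ = (C : ℂ) * ∑ c ∈ S, ⟪∑ b, mellin (f i b) (-(c : ℂ)) • v b, R c (∑ a, mellin (f j a) (-(c : ℂ)) • v a)⟫_ℂ) ∧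
      (∀ i, (w i : ℝ → V) =ᵐ[(volume : Measure ℝ).restrict (Ioi 0)] fun t => (∑ a, mellin (f i a) (-((((1 / 2 : ℝ)) : ℂ) + t * I)) • v a) +
        M ((((1 / 2 : ℝ)) : ℂ) + ((-t : ℝ) : ℂ) * I) (∑ a, mellin (f i a) (-((((1 / 2 : ℝ)) : ℂ) + ((-t : ℝ) : ℂ) * I)) • v a)) ∧
      (∀ i, Uiso ⟨∑ a, y i a, mem_topologicalClosure_span (fun i => ∑ a, y i a) i⟩ = WithLp.toLp 2 (r i, ((Real.sqrt (C * (2 * π)⁻¹) : ℝ) : ℂ) • w i)) := by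
  have hint : ∀ i j a b, Integrable fun t : ℝ => mellin (f j a) (-((σ₀ : ℂ) + t * I)) *
      (⟪v b, v a⟫_ℂ * conj (mellin (f i b) (-(1 - conj ((σ₀ : ℂ) + t * I)))) + ⟪v b, M ((σ₀ : ℂ) + t * I) (v a)⟫_ℂ * conj (mellin (f i b) (-conj ((σ₀ : ℂ) + t * I)))) :=
    fun i j a b => integrable_innerProductIntegrand_const_vertical_of_finset (hf j a) (hfs j a) (hf0 j a) (hf i b) (hfs i b) (hf0 i b) hσ₀ hUo hUs (hs a b) (fun c hc => (hS c hc).1) (hB a b) _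
      hσ₀.le le_rfl (fun c hc => (hS c hc).2.ne')
  exact exists_linearIsometry_selfDual_of_letters hf hfs hf0 v M hσ₀ hUo hUs S hS hs R hr hB hRsymm hRpos hPcd hFE hadj hcont (fun i => ∑ a, y i a) hC
    (inner_sum_sum_eq_vectorGram y v M f hint hSD)

end Generic

/-! ## §3 The `L²(K_U)`-model of a finite family of sections (the packaging of `V(χ, K′, ω)`; generic measure space `K`) -/

section Packaging

variable {K : Type*} [MeasurableSpace K] (μK : Measure K)

/-- A bounded (a.e.-strongly measurable) function on a finite measure space is in `L²` — the restrictions `φ_a|_{K_U}` of continuous bounded sections. [folklore] -/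
theorem memLp_two_of_bound [IsFiniteMeasure μK] {ψ : K → ℂ} (hψm : AEStronglyMeasurable ψ μK) {Cψ : ℝ} (hψC : ∀ k, ‖ψ k‖ ≤ Cψ) : MemLp ψ 2 μK :=
  MemLp.of_bound hψm Cψ (Eventually.of_forall hψC)

/-- **Representatives exist**: for finitely many bounded measurable `ψ_a` there are `v_a ∈ L²(K, μ_K)` with `v_a =ᵐ ψ_a`. [folklore] -/
theorem exists_rep [IsFiniteMeasure μK] {α : Type*} {ψ : α → K → ℂ} (hψm : ∀ a, AEStronglyMeasurable (ψ a) μK) (hψC : ∀ a, ∃ Cψ : ℝ, ∀ k, ‖ψ a k‖ ≤ Cψ) :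
    ∃ v : α → Lp ℂ 2 μK, ∀ a, (v a : K → ℂ) =ᵐ[μK] ψ a := by
  have h : ∀ a, MemLp (ψ a) 2 μK := fun a => by obtain ⟨Cψ, hC⟩ := hψC a; exact memLp_two_of_bound μK (hψm a) hC
  exact ⟨fun a => (h a).toLp _, fun a => MemLp.coeFn_toLp _⟩

/-- The span of finitely many vectors is finite-dimensional (so `V := ↥(span {v_a})` carries `FiniteDimensional`, hence is complete). [folklore] -/
theorem finiteDimensional_span_range {E : Type*} [AddCommGroup E] [Module ℂ E] {α : Type*} [Fintype α] (v : α → E) :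
    FiniteDimensional ℂ ↥(Submodule.span ℂ (Set.range v)) :=
  FiniteDimensional.span_of_finite ℂ (Set.finite_range v)

/-- **The inner product of the model vectors is the `L²(K)`-pairing**: in `W = span {v_a} ≤ L²(K, μ_K)`, `⟪v_b, v_a⟫_W = ∫_K ψ_a·conj ψ_b dμ_K` for representatives `v_a =ᵐ ψ_a`.
[cite: MoeglinWaldspurger1995, II.1.7] -/
theorem inner_mk_span_eq_integral {α : Type*} (v : α → Lp ℂ 2 μK) {ψ : α → K → ℂ} (hv : ∀ a, (v a : K → ℂ) =ᵐ[μK] ψ a) (a b : α) :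
    ⟪(⟨v b, Submodule.subset_span ⟨b, rfl⟩⟩ : ↥(Submodule.span ℂ (Set.range v))), ⟨v a, Submodule.subset_span ⟨a, rfl⟩⟩⟫_ℂ = ∫ k, ψ a k * conj (ψ b k) ∂μK := by
  rw [Submodule.coe_inner]
  exact inner_eq_integral_mul_conj (v b) (v a) (hv b) (hv a)

end Packaging

/-! ## §4 The `U(1,1)_{L∕L⁺}` print -/

section CM

variable (L : Type) [Field L] [NumberField L] [IsCMField L]
variable [MeasurableSpace (quasiSplit (↥(maximalRealSubfield L)) L (IsCMField.complexConj L) 2).Adelic] [BorelSpace (quasiSplit (↥(maximalRealSubfield L)) L (IsCMField.complexConj L) 2).Adelic]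

/-- **THE `L²`-CLASSES OF THE PURE TENSORS EXIST** (`U(1,1)_{L∕L⁺}`): for continuous bounded `χ`-sections `φ_a` and `f_{i,a} ∈ C_c((0,∞))` there are `y_{i,a} ∈ L²(X, μ)` with
`y_{i,a} =ᵐ θ_{f_{i,a},φ_a}` (★ (OD) `memLp_quotFun_chiPseudoEisenstein_cm_two`). [cite: MoeglinWaldspurger1995, II.1.2] -/
theorem exists_classRep_cm_two (μ : Measure (quasiSplit (↥(maximalRealSubfield L)) L (IsCMField.complexConj L) 2).automorphicQuotient)
    [(quasiSplit (↥(maximalRealSubfield L)) L (IsCMField.complexConj L) 2).IsAutomorphicMeasure μ]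
    {ι α : Type*} {χ : HeckeCharacter L} {φ : α → (quasiSplit (↥(maximalRealSubfield L)) L (IsCMField.complexConj L) 2).Adelic → ℂ}
    (hφ : ∀ a, IsChiSection χ (φ a)) (hφc : ∀ a, Continuous (φ a)) (hφC : ∀ a, ∃ Cφ : ℝ, ∀ g, ‖φ a g‖ ≤ Cφ)
    {f : ι → α → ℝ → ℂ} (hfc : ∀ i a, Continuous (f i a)) (hfs : ∀ i a, HasCompactSupport (f i a)) (hf0 : ∀ i a, tsupport (f i a) ⊆ Ioi 0) :
    ∃ y : ι → α → Lp ℂ 2 μ, ∀ i a, (y i a : (quasiSplit (↥(maximalRealSubfield L)) L (IsCMField.complexConj L) 2).automorphicQuotient → ℂ) =ᵐ[μ]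
      (quasiSplit (↥(maximalRealSubfield L)) L (IsCMField.complexConj L) 2).quotFun
        (eisensteinSeriesU (fun g : (quasiSplit (↥(maximalRealSubfield L)) L (IsCMField.complexConj L) 2).Adelic => f i a (borelHeight g : ℝ) * φ a g)) := by
  have h : ∀ i a, MemLp ((quasiSplit (↥(maximalRealSubfield L)) L (IsCMField.complexConj L) 2).quotFun
      (eisensteinSeriesU (fun g : (quasiSplit (↥(maximalRealSubfield L)) L (IsCMField.complexConj L) 2).Adelic => f i a (borelHeight g : ℝ) * φ a g))) 2 μ := fun i a => by
    obtain ⟨Cφ, hCφ⟩ := hφC a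
    exact memLp_quotFun_chiPseudoEisenstein_cm_two L μ 2 (hφ a) (hφc a) hCφ (hfc i a) (hfs i a) (hf0 i a)
  exact ⟨fun i a => (h i a).toLp _, fun i a => MemLp.coeFn_toLp _⟩

omit [BorelSpace (quasiSplit (↥(maximalRealSubfield L)) L (IsCMField.complexConj L) 2).Adelic] in
/-- **HEAD — THE PLANCHEREL ISOMETRY OF A SELF-DUAL `χ`-BLOCK OF `U(1,1)_{L∕L⁺}` AT A `K`-TYPE, ON LETTERS.**  Data: an automorphic measure space `L²(X, μ)`; a finite measure `μ_K` on the
maximal compact `K_U`; finitely many sections `φ_a` with `L²(K_U)`-representatives `v_a =ᵐ φ_a|_{K_U}` spanning the MODEL SPACE `W := span {v_a} ≤ L²(K_U, μ_K)` (finite-dimensional);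
test functions `f_{i,a} ∈ C²_c((0,∞))` and classes `y_{i,a} ∈ L²(X,μ)` (E1: `=ᵐ θ_{f_{i,a},φ_a}`, §4 `exists_classRep_cm_two`); the intertwining data `M, R : … → End W`.  LETTERS (payers):
the PURE-TENSOR two-term formula `hSD` on `Re z = σ₀` with coefficients `⟪v_b, v_a⟫_W = ∫_{K_U} φ_a·conj φ_b` (§3) and `⟪v_b, M(z)v_a⟫_W` (H-χ (SD), K2E3-p12); the MS ENTRY letters
`hs∕hr∕hB` ((b)-block at `(K′,ω)`, K2E1-p14); FE∕ADJOINT∕axis continuity (C3 + hconj, K2E1-p13); residue POSITIVITY.  CONCLUSION: `∃ r w U` with `⟪r_i, r_j⟫ = C·Σ_{c∈S} ⟪Ψ̂_i(−c), R_c Ψ̂_j(−c)⟫_W`,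
`w_i =ᵐ Ψ̂_i(−(½+it)) + M(½−it)Ψ̂_i(−(½−it))` and **`U (Σ_a y_{i,a}) = (r_i, √(C∕2π) • w_i)`**, `U : closure span {Σ_a y_{i,a}} →ₗᵢ[ℂ] (⊕_{c∈S} W) ⊕₂ L²((0,∞); W)` — the `(K′,ω)`-block
`Θ_χ^{(K′,ω)} ≅ (⊕_j Res_{χ,j}) ⊕ 𝓜_χ^{cont}` of ROADCARD §3′ D4′c for a self-dual `χ`. [cite: MoeglinWaldspurger1995, II.2.4, IV.3.12] [cite: GelbartRogawski1991, §3.1] -/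
theorem exists_linearIsometry_chiSection_selfDual_cm_two
    (μ : Measure (quasiSplit (↥(maximalRealSubfield L)) L (IsCMField.complexConj L) 2).automorphicQuotient)
    (μK : Measure ((standardMaximalCompactGL 2 L).comap (adelicVal (↥(maximalRealSubfield L)) L (IsCMField.complexConj L) 2 ((StdForm.antidiagonal 2).over L)) : Subgroup (quasiSplit (↥(maximalRealSubfield L)) L (IsCMField.complexConj L) 2).Adelic))
    {ι α : Type*} [Fintype α]
    (v : α → Lp ℂ 2 μK) (y : ι → α → Lp ℂ 2 μ) {f : ι → α → ℝ → ℂ}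
    (hf : ∀ i a, ContDiff ℝ 2 (f i a)) (hfs : ∀ i a, HasCompactSupport (f i a)) (hf0 : ∀ i a, tsupport (f i a) ⊆ Ioi 0)
    (M : ℂ → ↥(Submodule.span ℂ (Set.range v)) →ₗ[ℂ] ↥(Submodule.span ℂ (Set.range v))) {σ₀ : ℝ} (hσ₀ : 1 / 2 < σ₀)
    {U : Set ℂ} (hUo : IsOpen U) (hUs : {z : ℂ | 1 / 2 ≤ z.re ∧ z.re ≤ σ₀} ⊆ U) (S : Finset ℝ) (hS : ∀ c ∈ S, 1 / 2 < c ∧ c < σ₀)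
    (hs : ∀ a b, DifferentiableOn ℂ (fun z : ℂ => ⟪(⟨v b, Submodule.subset_span ⟨b, rfl⟩⟩ : ↥(Submodule.span ℂ (Set.range v))), M z ⟨v a, Submodule.subset_span ⟨a, rfl⟩⟩⟫_ℂ)
      (U \ ((S.image fun c : ℝ => (c : ℂ)) : Set ℂ)))
    (R : ℝ → ↥(Submodule.span ℂ (Set.range v)) →ₗ[ℂ] ↥(Submodule.span ℂ (Set.range v)))
    (hr : ∀ a b, ∀ c ∈ S, Tendsto (fun z : ℂ => (z - c) * ⟪(⟨v b, Submodule.subset_span ⟨b, rfl⟩⟩ : ↥(Submodule.span ℂ (Set.range v))), M z ⟨v a, Submodule.subset_span ⟨a, rfl⟩⟩⟫_ℂ)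
      (𝓝[≠] (c : ℂ)) (𝓝 ⟪(⟨v b, Submodule.subset_span ⟨b, rfl⟩⟩ : ↥(Submodule.span ℂ (Set.range v))), R c ⟨v a, Submodule.subset_span ⟨a, rfl⟩⟩⟫_ℂ))
    {B : ℝ} (hB : ∀ a b, ∀ z : ℂ, 1 / 2 < z.re → z.re ≤ σ₀ → 1 ≤ |z.im| →
      ‖⟪(⟨v b, Submodule.subset_span ⟨b, rfl⟩⟩ : ↥(Submodule.span ℂ (Set.range v))), M z ⟨v a, Submodule.subset_span ⟨a, rfl⟩⟩⟫_ℂ‖ ≤ B)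
    (hRsymm : ∀ c ∈ S, ∀ u u' : ↥(Submodule.span ℂ (Set.range v)), ⟪u, R c u'⟫_ℂ = ⟪R c u, u'⟫_ℂ)
    (hRpos : ∀ c ∈ S, ∀ u : ↥(Submodule.span ℂ (Set.range v)), 0 ≤ RCLike.re ⟪u, R c u⟫_ℂ)
    {P : Set ℂ} (hPcd : ∀ z₀ : ℂ, ∀ᶠ w in 𝓝[≠] z₀, w ∉ P)
    (hFE : ∀ z : ℂ, z ∉ P → 1 - z ∉ P → ∀ u : ↥(Submodule.span ℂ (Set.range v)), M (1 - z) (M z u) = u)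
    (hadj : ∀ z : ℂ, z ∉ P → conj z ∉ P → ∀ u u' : ↥(Submodule.span ℂ (Set.range v)), ⟪u, M z u'⟫_ℂ = ⟪M (conj z) u, u'⟫_ℂ)
    (hcont : ∀ u : ↥(Submodule.span ℂ (Set.range v)), Continuous fun t : ℝ => M ((((1 / 2 : ℝ)) : ℂ) + t * I) u)
    {C : ℝ} (hC : 0 ≤ C)
    (hSD : ∀ i j a b, ⟪y i b, y j a⟫_ℂ = (C : ℂ) * ((((2 * π)⁻¹ : ℝ) : ℂ) * ∫ t : ℝ, mellin (f j a) (-((σ₀ : ℂ) + t * I)) *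
      (⟪(⟨v b, Submodule.subset_span ⟨b, rfl⟩⟩ : ↥(Submodule.span ℂ (Set.range v))), ⟨v a, Submodule.subset_span ⟨a, rfl⟩⟩⟫_ℂ * conj (mellin (f i b) (-(1 - conj ((σ₀ : ℂ) + t * I)))) +
        ⟪(⟨v b, Submodule.subset_span ⟨b, rfl⟩⟩ : ↥(Submodule.span ℂ (Set.range v))), M ((σ₀ : ℂ) + t * I) ⟨v a, Submodule.subset_span ⟨a, rfl⟩⟩⟫_ℂ *
          conj (mellin (f i b) (-conj ((σ₀ : ℂ) + t * I)))))) :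
    ∃ (r : ι → PiLp 2 (fun _ : ↥S => ↥(Submodule.span ℂ (Set.range v)))) (w : ι → Lp ↥(Submodule.span ℂ (Set.range v)) 2 ((volume : Measure ℝ).restrict (Ioi 0)))
      (Uiso : (Submodule.span ℂ (Set.range fun i => ∑ a, y i a)).topologicalClosure →ₗᵢ[ℂ]
        WithLp 2 (PiLp 2 (fun _ : ↥S => ↥(Submodule.span ℂ (Set.range v))) × Lp ↥(Submodule.span ℂ (Set.range v)) 2 ((volume : Measure ℝ).restrict (Ioi 0)))),
      (∀ i j, ⟪r i, r j⟫_ℂ = (C : ℂ) * ∑ c ∈ S, ⟪∑ b, mellin (f i b) (-(c : ℂ)) • (⟨v b, Submodule.subset_span ⟨b, rfl⟩⟩ : ↥(Submodule.span ℂ (Set.range v))),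
        R c (∑ a, mellin (f j a) (-(c : ℂ)) • (⟨v a, Submodule.subset_span ⟨a, rfl⟩⟩ : ↥(Submodule.span ℂ (Set.range v))))⟫_ℂ) ∧
      (∀ i, (w i : ℝ → ↥(Submodule.span ℂ (Set.range v))) =ᵐ[(volume : Measure ℝ).restrict (Ioi 0)] fun t =>
        (∑ a, mellin (f i a) (-((((1 / 2 : ℝ)) : ℂ) + t * I)) • (⟨v a, Submodule.subset_span ⟨a, rfl⟩⟩ : ↥(Submodule.span ℂ (Set.range v)))) +
          M ((((1 / 2 : ℝ)) : ℂ) + ((-t : ℝ) : ℂ) * I) (∑ a, mellin (f i a) (-((((1 / 2 : ℝ)) : ℂ) + ((-t : ℝ) : ℂ) * I)) • (⟨v a, Submodule.subset_span ⟨a, rfl⟩⟩ : ↥(Submodule.span ℂ (Set.range v))))) ∧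
      (∀ i, Uiso ⟨∑ a, y i a, mem_topologicalClosure_span (fun i => ∑ a, y i a) i⟩ = WithLp.toLp 2 (r i, ((Real.sqrt (C * (2 * π)⁻¹) : ℝ) : ℂ) • w i)) := by
  haveI : FiniteDimensional ℂ ↥(Submodule.span ℂ (Set.range v)) := finiteDimensional_span_range v
  exact exists_linearIsometry_selfDual_of_pureTensor_letters y hf hfs hf0 (fun a => (⟨v a, Submodule.subset_span ⟨a, rfl⟩⟩ : ↥(Submodule.span ℂ (Set.range v)))) M hσ₀ hUo hUs S hS hs R hr hB
    hRsymm hRpos hPcd hFE hadj hcont hC hSD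

end CM

end Summit.HodgeConjecture.HodgeConjecture.Cruxes.H413.K2E1ChiSectionPlancherelSelfDualCMTwo

end
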